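import Literature.NumberTheory.Transcendental.KZFibredRelations
import Literature.NumberTheory.Transcendental.KZDominatedFamily
import Summits.KontsevichZagierPeriods.KontsevichZagierPeriods.Theses.ValuedFieldSpecialisation

/-!
# Route ValuedFieldSpecialisation — crux `ParametricLifting` (stmt-KontsevichZagierPeriods-3498),
line `registered`, tightness (b): THE ESCAPING-MASS FAMILY IS DOMINATED BY NOTHING

Helper (`--supports`) for item stmt-KontsevichZagierPeriods-3498 (line `registered`, lead c5,
stubs `sliceValue_escapingFamily` and `not_isDominatedFamily_escapingFamily`). The crux
`ParametricLifting` asks for fibred relations whose net is a `ℤ`-combination of DOMINATED families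
`KZ.IsDominatedFamily R r₀ g` (`Literature/NumberTheory/Transcendental/KZDominatedFamily.lean`):
(1) a uniform integrable envelope `g` of the slices near `s = 0⁺`, (2) a.e. convergence of the
slices of the domain to `r₀.domain`, (3) a.e. convergence of the integrands on `r₀.domain`. The
tightness lemmas of lead c5 show that each clause is load-bearing; this file is the witness for
clause (1), the envelope.

The **escaping-mass family** is any `E : KZ.IntegralRep 2` with
`E.domain = {(s, u) | 0 < u < s < 1}` (`z 0 = s` the parameter, `z 1 = u` the fibre variable) and
`E.integrand (s, u) = s⁻¹` (it is constructed, and shown fibred-equivalent to the unit square, by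
the sibling stub `exists_escapingFamily`; here it is a hypothesis).

* `sliceValue_escapingFamily` — for every `s ∈ (0, 1)` the slice of `E` over `s` is the interval
  `{u | 0 < u < s}` with the constant integrand `s⁻¹`, so `KZ.sliceValue E s = s · s⁻¹ = 1`:
  unit mass concentrating at `u = 0`.
* `not_isDominatedFamily_escapingFamily` — `E` is dominated by NOTHING: for every fibre point `u`
  the slice point `(s, u)` leaves `E.domain` as `s → 0⁺` (membership needs `u < s`), so clause (2)
  forces the special domain `r₀.domain` to be Lebesgue-null and `r₀.value = 0`, whereas dominated
  families specialise at value level (`KZ.IsDominatedFamily.tendsto_setIntegral`: slice values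
  `→ r₀.value`) and the slice values are constantly `1` near `0⁺` — `0 = 1`.

So clauses (2) and (3) alone (here with the empty special fibre) do not make the special fibre
account for the value of the family: without the envelope, mass escapes through the boundary of
the fibre. Sources: M. Kontsevich, D. Zagier, *Periods* (2001), §1.2 (the moves and families);
H. Lebesgue's dominated convergence theorem (Mathlib
`MeasureTheory.tendsto_integral_filter_of_dominated_convergence`, through
`KZ.IsDominatedFamily.tendsto_setIntegral`); the escaping-mass example `s⁻¹ · 𝟙_{(0,s)}` is the
textbook witness that the envelope hypothesis of dominated convergence cannot be dropped.
-/

noncomputable section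

namespace Summit.KontsevichZagierPeriods.ValuedFieldSpecialisation

open MeasureTheory Set Filter
open scoped Topology
open Literature.NumberTheory.Transcendental Literature.NumberTheory.Transcendental.KZ

/-- **Slices of the escaping-mass family have value `1`.** If `E : KZ.IntegralRep 2` has domain
`{(s, u) | 0 < s < 1, 0 < u < s}` and integrand `(s, u) ↦ s⁻¹`, then for every `s ∈ (0, 1)` the
slice set `{x : ℝ¹ | (s, x) ∈ E.domain}` is the box `{x | 0 < x 0 < s} = Set.pi univ (Ioo 0 s)` of
volume `s` (`Real.volume_pi_Ioo_toReal`) and the slice integrand is the constant `s⁻¹`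
(`MeasureTheory.setIntegral_const`), so `KZ.sliceValue E s = s · s⁻¹ = 1`.
[Kontsevich–Zagier 2001, §1.2] [folklore] -/
theorem sliceValue_escapingFamily :
    ∀ (E : KZ.IntegralRep 2), E.domain = {z | 0 < z 0 ∧ z 0 < 1 ∧ 0 < z 1 ∧ z 1 < z 0} → (E.integrand = fun z => (z 0)⁻¹) → ∀ s ∈ Set.Ioo (0 : ℝ) 1, KZ.sliceValue E s = 1 := by
  intro E hEd hEi s hs
  -- the slice over `s` is the box `(0, s)` in `ℝ¹`
  have hset : {x : Fin 1 → ℝ | Matrix.vecCons s x ∈ E.domain} = Set.pi univ fun _ => Ioo 0 s := by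
    ext x
    simp only [hEd, mem_setOf_eq, Matrix.cons_val_zero, Matrix.cons_val_one, mem_univ_pi, mem_Ioo,
      Fin.forall_fin_one]
    exact ⟨fun h => h.2.2, fun h => ⟨hs.1, hs.2, h⟩⟩
  rw [KZ.sliceValue_def, hEi, hset]
  -- the slice integrand is the constant `s⁻¹`, the box has volume `s`
  simp only [Matrix.cons_val_zero]
  rw [setIntegral_const, measureReal_def, Real.volume_pi_Ioo_toReal (fun _ => hs.1.le)]
  simp [hs.1.ne']

/-- **The escaping-mass family is dominated by nothing.** If `E : KZ.IntegralRep 2` has domain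
`{(s, u) | 0 < s < 1, 0 < u < s}` and integrand `(s, u) ↦ s⁻¹`, then `KZ.IsDominatedFamily E r₀ g`
fails for ALL `r₀ g : KZ.IntegralRep 1`. Indeed, a dominated family specialises at value level
(`KZ.IsDominatedFamily.tendsto_setIntegral`: the slice values tend to `r₀.value` along `𝓝[>] 0`),
and the slice values are `1` for `s ∈ (0, 1) ∈ 𝓝[>] 0` (`sliceValue_escapingFamily`), so
`r₀.value = 1`; but for EVERY `x : ℝ¹` the point `(s, x)` is eventually outside `E.domain` as
`s → 0⁺` (membership requires `0 < x 0 < s`), so clause (2) (`(s, x) ∈ E.domain ↔ x ∈ r₀.domain`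
eventually, for a.e. `x`) evaluated at a common `s` gives `x ∉ r₀.domain` for a.e. `x`, i.e.
`volume r₀.domain = 0` and `r₀.value = ∫ x in r₀.domain, r₀.integrand x = 0` — contradiction.
This is the textbook escaping-mass example showing that the envelope of Lebesgue's dominated
convergence theorem cannot be dropped, read in the families vocabulary of the crux.
[Kontsevich–Zagier 2001, §1.2; Lebesgue (dominated convergence)] [folklore] -/
theorem not_isDominatedFamily_escapingFamily :
    ∀ (E : KZ.IntegralRep 2), E.domain = {z | 0 < z 0 ∧ z 0 < 1 ∧ 0 < z 1 ∧ z 1 < z 0} → (E.integrand = fun z => (z 0)⁻¹) → ∀ (r₀ g : KZ.IntegralRep 1), ¬ KZ.IsDominatedFamily E r₀ g := by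
  intro E hEd hEi r₀ g h
  -- the slice values tend to `r₀.value`, but they are equal to `1` near `0⁺`
  have h1 : r₀.value = 1 := by
    have hev : ∀ᶠ s in 𝓝[>] (0 : ℝ), (1 : ℝ) = KZ.sliceValue E s := by
      filter_upwards [Ioo_mem_nhdsGT one_pos] with s hs
      exact (sliceValue_escapingFamily E hEd hEi s hs).symm
    exact tendsto_nhds_unique h.tendsto_setIntegral (tendsto_const_nhds.congr' hev)
  -- for EVERY fibre point `x`, `(s, x)` is outside `E.domain` for all small `s > 0`
  have h2 : ∀ x : Fin 1 → ℝ, ∀ᶠ s in 𝓝[>] (0 : ℝ), Matrix.vecCons s x ∉ E.domain := by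
    intro x
    rcases le_or_gt (x 0) 0 with hx | hx
    · refine Eventually.of_forall fun s hmem => ?_
      rw [hEd] at hmem
      simp only [mem_setOf_eq, Matrix.cons_val_zero, Matrix.cons_val_one] at hmem
      linarith [hmem.2.2.1]
    · filter_upwards [Ioo_mem_nhdsGT hx] with s hs hmem
      rw [hEd] at hmem
      simp only [mem_setOf_eq, Matrix.cons_val_zero, Matrix.cons_val_one] at hmem
      linarith [hmem.2.2.2, hs.2]
  -- hence the a.e. special domain is Lebesgue-null and `r₀.value = 0`
  have h3 : ∀ᵐ x : Fin 1 → ℝ, x ∉ r₀.domain := by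
    filter_upwards [h.ae_eventually_mem_iff] with x hx
    obtain ⟨s, hs1, hs2⟩ := (hx.and (h2 x)).exists
    exact fun hx0 => hs2 (hs1.mpr hx0)
  have h4 : r₀.value = 0 := by
    rw [KZ.IntegralRep.value]
    exact setIntegral_measure_zero _ (measure_eq_zero_iff_ae_notMem.mpr h3)
  exact one_ne_zero (h1.symm.trans h4)

end Summit.KontsevichZagierPeriods.ValuedFieldSpecialisation
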